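import Summits.AnomalousDissipation.AnomalousDissipation.Theorems.SolenoidalFractalHomogenisationLagrangianStepVmodSfTexts
import HarnessLib

/-!
# K1L_D (stmt-AnomalousDissipation-27980): (V_mod) FLAT STAGE — the per-label (sf) sideband text at GRID window starts `SFModeP_textEVH`
# (prover ad-k3l-bookkeeping-p1 g10, (sf) owner by RULING D28-5; grid-phase family of record by RULING D28-9; `--kind definition`; definition only)

RULING D28-9 re-cuts the (ℓ2) block family to grid window starts `s = j·(M·W.period/ν)` (finding F-k3l10-1: the coarse-label tools are
carrier-phase anchored; consumers are `s = 0` / grid objects).  This file is the (sf) lane's per-label text in that family: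
* **`SFModeP_textEVH e`** — `SFMode_textEVH e` (`…VmodSfTexts`, p717306) with the window binder `∀ s t, 0 ≤ s → s < t → t ≤ Tw → P < t − s →`
  replaced by `∀ j : ℕ, ∀ t, let s := j·(M·W.period/ν); s < t → t ≤ Tw → M·W.period/ν < t − s →` (everything else verbatim: binder list of
  `Bsf_textEVH`, inner regime of `BlockBound`, nonzero slow label, pair datum carried by `{ℓ,−ℓ}`, fast test, allowance `η·√dW·‖w‖·‖ζ‖`);
* `sfModeP_of_sfMode : SFMode_textEVH e → SFModeP_textEVH e` (general ⇒ grid; so the any-phase high rows `sfMode_high` feed the grid text).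
The rows proved in the lane (`…VmodSfCoarseMid`, `…VmodSfCoarseLong`, `…VmodSfHigh`) assemble to `SFModeP_textEVH (fun σ => min (σ/2) (1/2))`, and the
grid reduction `bsfP_of_sfModeP : SFModeP_textEVH e → Bsf_textEVHP e` is the companion proof file.  Definition only; NOT a proof of (sf), of the
stub, of K1L_D or AD; rung F-D1.A0.
-/

set_option linter.dupNamespace false

noncomputable section

namespace Summit.AnomalousDissipation.AnomalousDissipation.Theorems.SolenoidalFractalHomogenisation.LagrangianStep.VmodFlat

open Literature.Analysis Literature.Analysis.FluidPDE Literature.Analysis.FunctionSpaces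
open MeasureTheory Set Filter UnitAddTorus
open scoped ENNReal NNReal InnerProductSpace
open Summit.AnomalousDissipation.AnomalousDissipation.Theorems.SolenoidalFractalHomogenisation.LagrangianStep.CellClauseMod

/-- **(sf-mode)ᴾ — THE PER-LABEL SIDEBAND TARGET of the (sf) block on LONG windows at GRID starts** (`SFMode_textEVH` re-cut per RULING D28-9). -/
def SFModeP_textEVH (e : ℝ → ℝ) : Prop := ∀ k (W : LatticeShear.LatticeWord k) (M : ℝ) (hM : 0 < M) (c : ℝ), 0 < c →
  ∀ (Φ : ℝ → Torus.Visc4 (Fin 3) → Torus.Visc4 (Fin 3)) (lo hi Λ β σ C ν₀ K : ℝ),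
    0 < lo → lo ≤ 1 → 1 ≤ hi → 1 < Λ → 0 ≤ β → 0 < σ → 0 ≤ C → 0 < ν₀ → ν₀ ≤ 1 → 0 < K →
    SlowVectorClauseF W M hM c Φ lo hi Λ β σ C ν₀ K →
    (∀ Kb : ℝ, 1 ≤ Kb → ∃ CK : ℝ, 1 ≤ CK ∧ ∃ cK > (0:ℝ), ∃ νh > (0:ℝ), HighLabelDecayW W M hM lo hi Λ β νh Kb CK cK) →
    ∃ C₂ : ℝ, 0 ≤ C₂ ∧
    ∀ ν, ∀ hν : ν ∈ Set.Ioo 0 ν₀, ∀ n : ℕ, (⌈K / ν⌉₊ : ℝ) ≤ n → ∀ 𝔸 : Torus.Visc4 (Fin 3),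
      Torus.OddSmall 𝔸 (ν * β) → (∃ lam ∈ Set.Icc (1:ℝ) Λ, Torus.NearIso 𝔸 (ν * (lo / lam)) (ν * (hi * lam))) →
      Torus.OddSmall (Φ ν ((1 / ν) • 𝔸)) β → (∃ lam ∈ Set.Icc (1:ℝ) Λ, Torus.NearIso (Φ ν ((1 / ν) • 𝔸)) (lo / lam) (hi * lam)) →
      ∀ Tw > (0:ℝ), ∀ U T : ℝ → ℝ → (V2 →L[ℝ] V2),
        Torus.IsPropagator Tw (cellField W M hM ν hν.1 n) ((1 / (n:ℝ) ^ 2) • 𝔸) U →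
        Torus.IsPropagator Tw (fun _ _ => 0) ((1 / (n:ℝ) ^ 2) • (𝔸 + (c / ν) • Φ ν ((1 / ν) • 𝔸))) T →
      ∀ j : ℕ, ∀ t : ℝ, let s : ℝ := (j : ℝ) * (M * W.period / ν); s < t → t ≤ Tw → M * W.period / ν < t - s →
      ∀ ℓ ∈ (Torus.freqBall (d := Fin 3) (n / 4)).erase 0, ∀ w : V2, w ∈ Torus.divFreeL2 (Fin 3) →
        (∀ k', k' ≠ ℓ → k' ≠ -ℓ → fc w k' = 0) → ∀ ζ : V2, IsFast n ζ →
        |⟪U s t w, ζ⟫_ℝ|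
          ≤ (C₂ * (C₂ * (ν ^ e σ + ((⌈K / ν⌉₊ : ℝ) / n) ^ e σ) + (min 1 ((M * W.period / ν) / (t - s))) ^ e σ))
            * Real.sqrt (dW lo Λ c ν n (t - s) ℓ) * ‖w‖ * ‖ζ‖

/-- Bridge (general ⇒ grid): `SFMode_textEVH e → SFModeP_textEVH e`. -/
theorem sfModeP_of_sfMode (e : ℝ → ℝ) (h : SFMode_textEVH e) : SFModeP_textEVH e := by
  intro k W M hM c hc Φ lo hi Λ β σ C ν₀ K hlo hlo1 hhi hΛ hβ hσ hC hν₀ hν₀1 hK hV hH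
  obtain ⟨C₂, hC₂, hm⟩ := h k W M hM c hc Φ lo hi Λ β σ C ν₀ K hlo hlo1 hhi hΛ hβ hσ hC hν₀ hν₀1 hK hV hH
  refine ⟨C₂, hC₂, ?_⟩
  intro ν hν n hn 𝔸 hodd hwin hΦo hΦw Tw hTw U T hU hT j t s hst htT hlong ℓ hℓ w hw hws ζ hζ
  have hs : 0 ≤ s := by
    show (0:ℝ) ≤ (j : ℝ) * (M * W.period / ν)
    exact mul_nonneg (Nat.cast_nonneg j) (div_nonneg (mul_nonneg hM.le
      (Summit.AnomalousDissipation.AnomalousDissipation.Theorems.SolenoidalFractalHomogenisation.PermissibleCarrier.period_pos W).le) hν.1.le)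
  exact hm ν hν n hn 𝔸 hodd hwin hΦo hΦw Tw hTw U T hU hT s t hs hst htT hlong ℓ hℓ w hw hws ζ hζ

end Summit.AnomalousDissipation.AnomalousDissipation.Theorems.SolenoidalFractalHomogenisation.LagrangianStep.VmodFlat

end
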